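import Summits.QuantumFields.YangMills.Theorems.BalabanUVNodesN15KingModelBlockSpinTransformation
import Summits.QuantumFields.YangMills.Theorems.BalabanUVNodesN15KingModelMassStrictMonotonicity

/-!
# BalabanUVNodes ∕ N15 — THE KING-MODEL RUNG (PART Ϻ-ee): THE BLOCK-SPIN MAPS FORM A SEMIGROUP — `R_L ∘ R_{L′} = R_{LL′}`, `R_1 = id`, `R_L^n = R_{L^n}`, matching the mass flow
# `m ↦ Lm ↦ LL′m` of part Ϻ-dd — and THE MASSLESS FIELD IS THE ONLY FIXED POINT IN KING'S FAMILY: `(R_L)_*μ_{∞,m²} ≠ μ_{∞,m²}` for `L ≥ 2`, `m² > 0` (part Ϻ-gg's faithfulness of the mass)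
# (Track A, DAG node N15 = NE2; FAN-OUT v1.1 §N15 s3 «KING-MODEL RUNG»; count-neutral)

HONEST FRAMING.  Count-neutral (cell `pub-ymgap`, seat `pub-ymgap-dag-n15-e` g36; `--supports stmt-QuantumFields-27366 --as helper` = K3⁸).  King's `A = 0`, `g = 0` model
([King1986] C. King, Commun. Math. Phys. **102** (1986) 649–677).  The block-spin map `(R_Lφ)(z) = (L^{d+3})^{−1∕2}Σ_{a∈[0,L)^{d+1}}φ(Lz + a)` of part Ϻ-dd satisfies the exact
SEMIGROUP LAW ★★ `R_L(R_{L′}φ) = R_{LL′}φ` (the `L′`-blocks of `L`-blocks are the `LL′`-blocks: `L′(Lz + a) + a′ = LL′z + (L′a + a′)` with `(a,a′) ↦ L′a + a′` a bijection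
`[0,L)^{d+1} × [0,L′)^{d+1} → [0,LL′)^{d+1}`, and `(L^{d+3})^{−1∕2}(L′^{d+3})^{−1∕2} = ((LL′)^{d+3})^{−1∕2}`), ★ `R_1 = id`, ★ `R_L^{∘n} = R_{L^n}`; consequently the push-forward action
on King's fields (part Ϻ-dd: `(R_L)_*μ_{∞,m²} = μ_{∞,L²m²}`) is a representation of the multiplicative monoid of scales: ★★ `(R_{L^n})_*μ_{∞,m²} = μ_{∞,L^{2n}m²}`, `(R_{L^n})_*μ⁰_∞ = μ⁰_∞`; and since the mass parametrises the family
faithfully (part Ϻ-gg), ★★★ **NO MASSIVE KING FIELD IS A FIXED POINT**: `(R_L)_*μ_{∞,m²} ≠ μ_{∞,m²}` (`L ≥ 2`), while `(R_L)_*μ⁰_∞ = μ⁰_∞` — the mass is a RELEVANT direction (eigenvalue `L²` on `m²`)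
and `μ⁰_∞` the unique fixed point of the block-spin RG within `{μ_{∞,m²}}_{m²>0} ∪ {μ⁰_∞}`.  NOT Bałaban's objects; NOT a node discharge; nothing continuum-Yang–Mills ∕ `ℝ⁴` ∕ OS ∕ Clay.  0 `sorry`, 0 def; standard axioms.

WHAT THIS FILE PROVES (kernel).  `blockSite_blockSite`, `sqrt_pow_mul_inv`, ★★ **`blockRG_blockRG`**, `blockRG_comp`, `blockSite_one`, ★ `blockRG_one`, ★ **`blockRG_iterate`**, ★★ `kingFieldInf_map_blockRG_pow`,
`kingFieldInf0_map_blockRG_pow`, ★★★ **`kingFieldInf_map_blockRG_ne_self`**, `kingFieldInf_map_blockRG_pow_ne_self`, ★★ **`blockRG_fixed_point_unique`**.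

HONEST SCOPE.  Pure bookkeeping of the block-spin maps on `ℝ^{ℤ^{d+1}}`; King's free fields only.  N15 untouched; counts unmoved.  Locators (use): [King1986] §2 (2.3)–(2.6) p.652.
-/

noncomputable section

open scoped BigOperators Topology
open Filter MeasureTheory ProbabilityTheory Finset

namespace Summit.QuantumFields.YangMills.BalabanUVNodes.N15KingModelRung.InfiniteVolume

variable {d : ℕ}

/-- Blocks of blocks: `L′(Lz + a) + a′ = LL′z + (a′ + L′a)`, the inner index read through `finProdFinEquiv : Fin L × Fin L′ ≃ Fin (LL′)`. [cite: King1986, §2 (2.3) p.652] -/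
theorem blockSite_blockSite (L L' : ℕ) (z : Fin (d + 1) → ℤ) (a : Fin (d + 1) → Fin L) (a' : Fin (d + 1) → Fin L') :
    blockSite L' (blockSite L z a) a' = blockSite (L * L') z (fun μ => finProdFinEquiv (a μ, a' μ)) := by
  funext μ
  have hval : ((finProdFinEquiv (a μ, a' μ) : Fin (L * L')) : ℕ) = (a' μ : ℕ) + L' * (a μ : ℕ) := rfl
  simp only [blockSite, hval]
  push_cast
  ring

/-- `(√(L^{d+3}))⁻¹(√(L′^{d+3}))⁻¹ = (√((LL′)^{d+3}))⁻¹`. [folklore] -/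
theorem sqrt_pow_mul_inv (L L' : ℕ) :
    (Real.sqrt ((L : ℝ) ^ (d + 3)))⁻¹ * (Real.sqrt ((L' : ℝ) ^ (d + 3)))⁻¹ = (Real.sqrt ((((L * L' : ℕ)) : ℝ) ^ (d + 3)))⁻¹ := by
  rw [← mul_inv, ← Real.sqrt_mul (pow_nonneg (Nat.cast_nonneg L) _), ← mul_pow, Nat.cast_mul]

/-- ★★ **THE SEMIGROUP LAW OF THE BLOCK-SPIN MAPS**: `R_L(R_{L′}φ) = R_{LL′}φ`. [cite: King1986, §2 (2.3)–(2.6) p.652] -/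
theorem blockRG_blockRG (L L' : ℕ) (ω : (Fin (d + 1) → ℤ) → ℝ) : blockRG d L (blockRG d L' ω) = blockRG d (L * L') ω := by
  funext z
  simp only [blockRG]
  rw [← Finset.mul_sum, ← mul_assoc, sqrt_pow_mul_inv]
  congr 1
  -- reindex the double sum over `[0,L)^{d+1} × [0,L′)^{d+1}` by `[0,LL′)^{d+1}`
  let e : ((Fin (d + 1) → Fin L) × (Fin (d + 1) → Fin L')) ≃ (Fin (d + 1) → Fin (L * L')) :=
    (Equiv.arrowProdEquivProdArrow (Fin (d + 1)) (fun _ => Fin L) (fun _ => Fin L')).symm.trans (Equiv.piCongrRight fun _ => finProdFinEquiv)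
  rw [← Fintype.sum_prod_type']
  exact Fintype.sum_equiv e _ _ fun p => by rw [blockSite_blockSite]; rfl

/-- `R_L ∘ R_{L′} = R_{LL′}`. [folklore] -/
theorem blockRG_comp (L L' : ℕ) : blockRG d L ∘ blockRG d L' = blockRG d (L * L') := by
  funext ω
  exact blockRG_blockRG L L' ω

/-- The `1`-blocks are the sites. [folklore] -/
theorem blockSite_one (z : Fin (d + 1) → ℤ) (a : Fin (d + 1) → Fin 1) : blockSite 1 z a = z := by
  funext μ
  simp [blockSite]

/-- ★ `R_1 = id`. [folklore] -/
theorem blockRG_one : blockRG d 1 = id := by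
  funext ω z
  simp [blockRG, blockSite_one]

/-- ★ **`R_L^{∘n} = R_{L^n}`**. [folklore] -/
theorem blockRG_iterate (L n : ℕ) : (blockRG d L)^[n] = blockRG d (L ^ n) := by
  induction n with
  | zero => rw [Function.iterate_zero, pow_zero, blockRG_one]
  | succ n ih => rw [Function.iterate_succ', ih, blockRG_comp, pow_succ']

/-- ★★ `(R_{L^n})_*μ_{∞,m²} = μ_{∞,L^{2n}m²}` — the monoid of scales acts on King's block fields through the mass. [cite: King1986, §2 (2.3)–(2.6) p.652, Thm 2.1 (2.22) p.654] -/
theorem kingFieldInf_map_blockRG_pow {m2 : ℝ} (hm : 0 < m2) {L : ℕ} (hL : 1 ≤ L) (n : ℕ) :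
    (kingFieldInf (d := d) m2).map (blockRG d (L ^ n)) = kingFieldInf (((L : ℝ) ^ 2) ^ n * m2) := by
  rw [← blockRG_iterate, kingFieldInf_map_blockRG_iterate hm hL n]

/-- `(R_{L^n})_*μ⁰_∞ = μ⁰_∞` (`d + 1 ≥ 3`). [folklore] -/
theorem kingFieldInf0_map_blockRG_pow (hd : 2 ≤ d) {L : ℕ} (hL : 1 ≤ L) (n : ℕ) : (kingFieldInf0 d).map (blockRG d (L ^ n)) = kingFieldInf0 d := by
  rw [← blockRG_iterate, kingFieldInf0_map_blockRG_iterate hd hL n]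

/-! ## The massless field is the only fixed point in King's family -/

/-- ★★★ **NO MASSIVE KING FIELD IS AN RG FIXED POINT**: `(R_L)_*μ_{∞,m²} = μ_{∞,L²m²} ≠ μ_{∞,m²}` for `L ≥ 2`, `m² > 0` — the mass is a relevant direction. [cite: King1986, §2 (2.3)–(2.6) p.652] -/
theorem kingFieldInf_map_blockRG_ne_self {m2 : ℝ} (hm : 0 < m2) {L : ℕ} (hL : 2 ≤ L) : (kingFieldInf (d := d) m2).map (blockRG d L) ≠ kingFieldInf m2 := by
  rw [kingFieldInf_map_blockRG hm (by omega : 1 ≤ L)]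
  have hL2 : (2 : ℝ) ≤ L := by exact_mod_cast hL
  have hne : (L : ℝ) ^ 2 * m2 ≠ m2 := by
    intro h
    have h4 : 4 * m2 ≤ (L : ℝ) ^ 2 * m2 := mul_le_mul_of_nonneg_right (by nlinarith) hm.le
    linarith
  exact kingFieldInf_ne_of_ne (by positivity) hm hne

/-- No iterate fixes a massive field either: `(R_{L^n})_*μ_{∞,m²} ≠ μ_{∞,m²}` (`L ≥ 2`, `n ≥ 1`). [folklore] -/
theorem kingFieldInf_map_blockRG_pow_ne_self {m2 : ℝ} (hm : 0 < m2) {L : ℕ} (hL : 2 ≤ L) {n : ℕ} (hn : 1 ≤ n) :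
    (kingFieldInf (d := d) m2).map (blockRG d (L ^ n)) ≠ kingFieldInf m2 := by
  refine kingFieldInf_map_blockRG_ne_self hm ?_
  calc 2 ≤ L := hL
    _ = L ^ 1 := (pow_one L).symm
    _ ≤ L ^ n := Nat.pow_le_pow_right (by omega) hn

/-- ★★ **UNIQUENESS OF THE FIXED POINT IN KING'S FAMILY** (`L ≥ 2`): among the laws `μ_{∞,m²}` (`m² > 0`) and `μ⁰_∞`, a law `ν` with `(R_L)_*ν = ν` must be `μ⁰_∞`.
[cite: King1986, §2 (2.3)–(2.6) p.652, Thm 2.1 (2.22) p.654] -/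
theorem blockRG_fixed_point_unique {L : ℕ} (hL : 2 ≤ L) {ν : Measure ((Fin (d + 1) → ℤ) → ℝ)}
    (hν : ν = kingFieldInf0 d ∨ ∃ m2 : ℝ, 0 < m2 ∧ ν = kingFieldInf m2) (hfix : ν.map (blockRG d L) = ν) : ν = kingFieldInf0 d := by
  rcases hν with h | ⟨m2, hm, h⟩
  · exact h
  · exact absurd (h ▸ hfix) (kingFieldInf_map_blockRG_ne_self hm hL)

end Summit.QuantumFields.YangMills.BalabanUVNodes.N15KingModelRung.InfiniteVolume
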